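import Literature.MathematicalPhysics.QuantumLattice.FreeFermionSectorEnergyDeviation
import HarnessLib

/-!
# Canonical ground states of the free torus in the sectors `(2n, S^z = 0)`: paired Fermi seas,
# exact floor, and degeneracy of open shells

Family `hubbard` / topic `MathematicalPhysics/QuantumLattice`. For the free Hubbard torus
`H₀ = hubbardTorus 2 L 1 0 = Σ_{kσ} ε_L(k) n_{kσ}` (`L ≥ 3`) and a Fermi set `F` of `n` lowest band
levels with level `ε_F` (`ε ≤ ε_F` on `F`, `ε_F ≤ ε` off `F`):

* `two_mul_sum_fermiSet_le_re_expect_free` — every unit vector of `szSector (2n) 0` has kinetic energy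
  `≥ 2 Σ_{k∈F} ε_L(k)` (the bathtub bound `sum_fermiSet_le` of `FreeFermionSectorEnergyDeviation.lean`
  for both spins);
* `minEnergyOn_szSector_free_eq` — hence the sector floor IS `2 Σ_{k∈F} ε_L(k)` (the paired Fermi sea
  `Φ_F = Π_{k∈F} b†_k |0⟩` of `PairedProductStates.lean` attains it, `minEnergyOn_szSector_hubbardTorus_zero_le`);
* `hubbardTorus_zero_mulVec_pairedState` — `Φ_l` is an EIGENVECTOR: `H₀ Φ_l = 2 Σ_{k∈l} ε_L(k) · Φ_l`;
* `isGroundStateInSector_pairedState_free` — so `Φ_F` is a ground state of the joint sector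
  `(2n, S^z = 0)` in the sense of `IsGroundStateInSector`;
* `pairedState_ne_smul` — paired seas over different momentum sets are never proportional (`n_{q↑}`
  separates them);
* `exists_two_fermiSets` (abstract levels) and `exists_two_groundStates_free_of_openShell` — an OPEN
  shell, `#{ε_L < μ} < n < #{ε_L ≤ μ}`, carries two Fermi sets of `n` levels differing in a shell
  momentum, hence two non-proportional ground states of the sector `(2n, S^z = 0)`.

Consumer: `Summits/HubbardSuperconductivity/…/Theorems/JosephsonMirrorJmCuspFreeLayersNotSimple.lean` (the
`U = 0` calibration of the eventual-simplicity clause of the crux `JmCusp`). Sources: J. Bardeen,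
L. N. Cooper, J. R. Schrieffer, Phys. Rev. 108 (1957) 1175, §II; E. H. Lieb, M. Loss, *Analysis*
(AMS, 2001), Thm 1.14 (bathtub principle); E. H. Lieb, Phys. Rev. Lett. 62 (1989) 1201 (the `(n, n)`
sector). Folklore finite-dimensional statements; no definitions, no named facts.

## Mathlib / tree search

Tree: `sum_fermiSet_le`, `sum_re_expect_momentumNumber_up/down`, `re_expect_momentumNumber_mem_Icc`,
`mem_szSector_two_mul_zero_iff`, `hubbardTorusWith_zero_eq_sum_pairBlock_kinetic`,
`momentumNumber_{up,down}_pairedState_of_{mem,not_mem}`, `pairedState_mem_szSector`,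
`star_pairedState_dotProduct_self`, `minEnergyOn_szSector_hubbardTorus_zero_le` (upper bound only — the
matching lower bound and the eigenvector property are what this file adds). Mathlib:
`Finset.exists_subset_card_eq`, `le_csInf`.
-/

noncomputable section

namespace Literature.MathematicalPhysics.QuantumLattice

open Matrix Finset Literature.Probability.LatticeModels
open scoped ComplexOrder ComplexConjugate

/-! ### Two Fermi sets on an open shell (abstract levels) -/

/-- **An open shell carries two Fermi sets.** For levels `ε : ι → ℝ`, a level `μ` and a particle
number `n` with `#{ε < μ} < n < #{ε ≤ μ}` there are two sets `F, F'` of `n` lowest levels with Fermi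
level `μ` (`ε ≤ μ` on the set, `μ ≤ ε` off it) and a momentum `q ∈ F' ∖ F` (fill `{ε < μ}` and
complete with two different subsets of the shell `{ε = μ}`). [folklore] -/
theorem exists_two_fermiSets {ι : Type*} [Fintype ι] [DecidableEq ι] (ε : ι → ℝ) (μ : ℝ) (n : ℕ)
    (hlt : (univ.filter fun k => ε k < μ).card < n) (hgt : n < (univ.filter fun k => ε k ≤ μ).card) :
    ∃ F F' : Finset ι, F.card = n ∧ F'.card = n ∧
      (∀ k ∈ F, ε k ≤ μ) ∧ (∀ k ∉ F, μ ≤ ε k) ∧ (∀ k ∈ F', ε k ≤ μ) ∧ (∀ k ∉ F', μ ≤ ε k) ∧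
      ∃ q, q ∈ F' ∧ q ∉ F := by
  set B : Finset ι := univ.filter fun k => ε k < μ with hB
  set A : Finset ι := univ.filter fun k => ε k ≤ μ with hA
  have hBA : B ⊆ A := fun k hk => by
    rw [hB, mem_filter] at hk
    rw [hA, mem_filter]
    exact ⟨hk.1, hk.2.le⟩
  set Sh : Finset ι := A \ B with hSh
  have hShc : Sh.card = A.card - B.card := card_sdiff_of_subset hBA
  have hmemSh : ∀ k, k ∈ Sh ↔ ε k = μ := fun k => by
    rw [hSh, mem_sdiff, hA, hB, mem_filter, mem_filter]
    simp only [mem_univ, true_and, not_lt]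
    exact ⟨fun h => le_antisymm h.1 h.2, fun h => ⟨h.le, h.ge⟩⟩
  obtain ⟨T, hTSh, hTc⟩ := exists_subset_card_eq (s := Sh) (n := n - B.card) (by omega)
  have hTlt : T.card < Sh.card := by omega
  obtain ⟨q, hq⟩ : (Sh \ T).Nonempty := by
    rw [← card_pos, card_sdiff_of_subset hTSh]; omega
  rw [mem_sdiff] at hq
  obtain ⟨p, hp⟩ : T.Nonempty := by rw [← card_pos]; omega
  set T' : Finset ι := insert q (T.erase p) with hT'
  have hT'Sh : T' ⊆ Sh := by
    intro k hk
    rw [hT', mem_insert, mem_erase] at hk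
    rcases hk with rfl | hk
    · exact hq.1
    · exact hTSh hk.2
  have hT'c : T'.card = T.card := by
    rw [hT', card_insert_of_notMem, card_erase_of_mem hp, Nat.sub_add_cancel (card_pos.2 ⟨p, hp⟩)]
    rw [mem_erase]
    exact fun h => hq.2 h.2
  have hdisjT : Disjoint B T := by
    rw [disjoint_iff_ne]
    rintro k hk _ hk' rfl
    exact (mem_sdiff.1 (hTSh hk')).2 hk
  have hdisjT' : Disjoint B T' := by
    rw [disjoint_iff_ne]
    rintro k hk _ hk' rfl
    exact (mem_sdiff.1 (hT'Sh hk')).2 hk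
  -- Fermi property of `B ∪ T` for any `T ⊆ Sh`
  have fermi : ∀ T₀ : Finset ι, T₀ ⊆ Sh →
      (∀ k ∈ B ∪ T₀, ε k ≤ μ) ∧ (∀ k ∉ B ∪ T₀, μ ≤ ε k) := by
    intro T₀ hT₀
    refine ⟨fun k hk => ?_, fun k hk => ?_⟩
    · rcases mem_union.1 hk with hk | hk
      · exact (mem_filter.1 (hBA hk)).2
      · exact ((hmemSh k).1 (hT₀ hk)).le
    · rw [mem_union, not_or, hB, mem_filter] at hk
      simpa using hk.1
  refine ⟨B ∪ T, B ∪ T', ?_, ?_, (fermi T hTSh).1, (fermi T hTSh).2, (fermi T' hT'Sh).1,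
    (fermi T' hT'Sh).2, q, mem_union_right _ (by rw [hT']; exact mem_insert_self _ _), ?_⟩
  · rw [card_union_of_disjoint hdisjT]; omega
  · rw [card_union_of_disjoint hdisjT', hT'c]; omega
  · rw [mem_union, not_or]
    exact ⟨(mem_sdiff.1 hq.1).2, hq.2⟩

/-! ### The free torus: sector floors and paired Fermi seas -/

section Free

variable {L : ℕ} [NeZero L]

/-- **Bathtub lower bound on the free sector energy.** For `L ≥ 3`, a Fermi set `F` of `n` band
levels with level `ε_F`, and a unit vector `ψ ∈ szSector (2n) 0`:
`2 Σ_{k∈F} ε_L(k) ≤ Re ⟨ψ, H₀ ψ⟩` (`H₀ = hubbardTorus 2 L 1 0`; the Bloch occupations of each spin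
lie in `[0,1]` and sum to `n`). Bardeen–Cooper–Schrieffer (1957) §II; Lieb–Loss (2001) Thm 1.14.
[folklore] -/
theorem two_mul_sum_fermiSet_le_re_expect_free (hL : 3 ≤ L) {n : ℕ}
    {ψ : Fock (Orb (FermionTorus 2 L))} (hψ : ψ ∈ szSector (Λ := FermionTorus 2 L) (2 * n) 0)
    (h1 : star ψ ⬝ᵥ ψ = 1) (F : Finset (TorusSite 2 L)) (eF : ℝ) (hFc : F.card = n)
    (hF : ∀ k ∈ F, torusBand L k ≤ eF) (hF' : ∀ k ∉ F, eF ≤ torusBand L k) :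
    2 * ∑ k ∈ F, torusBand L k ≤ (star ψ ⬝ᵥ (hubbardTorus 2 L 1 0 *ᵥ ψ)).re := by
  have hsec : IsInSector n n ψ := (mem_szSector_two_mul_zero_iff n ψ).1 hψ
  set x : TorusSite 2 L → ℝ := fun k => (star ψ ⬝ᵥ (momentumNumber k 0 *ᵥ ψ)).re with hx
  have hx0 : ∀ k, 0 ≤ x k := fun k => (re_expect_momentumNumber_mem_Icc k 0 ψ).1
  have hx1 : ∀ k, x k ≤ 1 := fun k => by
    have := (re_expect_momentumNumber_mem_Icc k 0 ψ).2
    rwa [h1, Complex.one_re] at this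
  have hz0 : ∀ k : TorusSite 2 L, 0 ≤ (star ψ ⬝ᵥ (momentumNumber (-k) 1 *ᵥ ψ)).re := fun k =>
    (re_expect_momentumNumber_mem_Icc (-k) 1 ψ).1
  have hz1 : ∀ k : TorusSite 2 L, (star ψ ⬝ᵥ (momentumNumber (-k) 1 *ᵥ ψ)).re ≤ 1 := fun k => by
    have := (re_expect_momentumNumber_mem_Icc (-k) 1 ψ).2
    rwa [h1, Complex.one_re] at this
  have hxs : ∑ k, x k = F.card := by
    rw [hFc]
    have := sum_re_expect_momentumNumber_up (L := L) hsec
    rwa [h1, Complex.one_re, mul_one] at this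
  have hzs : ∑ k : TorusSite 2 L, (star ψ ⬝ᵥ (momentumNumber (-k) 1 *ᵥ ψ)).re = F.card := by
    rw [hFc]
    have := sum_re_expect_momentumNumber_down (L := L) hsec
    rw [h1, Complex.one_re, mul_one] at this
    rw [← this]
    exact Equiv.sum_comp (Equiv.neg (TorusSite 2 L))
      (fun k => (star ψ ⬝ᵥ (momentumNumber k 1 *ᵥ ψ)).re)
  have hE : (star ψ ⬝ᵥ (hubbardTorus 2 L 1 0 *ᵥ ψ)).re =
      ∑ k, torusBand L k * x k + ∑ k : TorusSite 2 L, torusBand L k *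
        (star ψ ⬝ᵥ (momentumNumber (-k) 1 *ᵥ ψ)).re := by
    rw [← hubbardTorusWith_zero, hubbardTorusWith_zero_eq_sum_pairBlock_kinetic hL 0, Matrix.sum_mulVec,
      dotProduct_sum, Complex.re_sum, ← Finset.sum_add_distrib]
    refine Finset.sum_congr rfl fun k _ => ?_
    rw [Matrix.smul_mulVec, dotProduct_smul, smul_eq_mul, Complex.re_ofReal_mul, add_mulVec,
      dotProduct_add, Complex.add_re, sub_zero]
    ring
  have hbx := sum_fermiSet_le (torusBand L) x F eF hF hF' hx0 hx1 hxs
  have hbz := sum_fermiSet_le (torusBand L) (fun k => (star ψ ⬝ᵥ (momentumNumber (-k) 1 *ᵥ ψ)).re)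
    F eF hF hF' hz0 hz1 hzs
  rw [hE]
  linarith

/-- **The free sector floor is the doubled sum of the `n` lowest levels.** For `L ≥ 3` and a Fermi
set `F` with level `ε_F`: `minEnergyOn H₀ (szSector (2|F|) 0) = 2 Σ_{k∈F} ε_L(k)` (bathtub from
below, the paired Fermi sea `Φ_F` from above, `minEnergyOn_szSector_hubbardTorus_zero_le`).
Bardeen–Cooper–Schrieffer (1957) §II. [folklore] -/
theorem minEnergyOn_szSector_free_eq (hL : 3 ≤ L) (F : Finset (TorusSite 2 L)) (eF : ℝ)
    (hF : ∀ k ∈ F, torusBand L k ≤ eF) (hF' : ∀ k ∉ F, eF ≤ torusBand L k) :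
    (hubbardTorus 2 L 1 0).minEnergyOn (szSector (Λ := FermionTorus 2 L) (2 * F.card) 0) =
      2 * ∑ k ∈ F, torusBand L k := by
  classical
  refine le_antisymm (minEnergyOn_szSector_hubbardTorus_zero_le hL F) ?_
  have hmem : ((List.map (fun k : TorusSite 2 L => (pairMode k)ᴴ) F.toList).prod *ᵥ (vacuum : Fock (Orb (FermionTorus 2 L)))) ∈ szSector (Λ := FermionTorus 2 L) (2 * F.card) 0 := by
    rw [← F.length_toList]; exact pairedState_mem_szSector F.toList
  refine le_csInf ⟨_, ((List.map (fun k : TorusSite 2 L => (pairMode k)ᴴ) F.toList).prod *ᵥ (vacuum : Fock (Orb (FermionTorus 2 L)))), hmem, star_pairedState_dotProduct_self F.nodup_toList, rfl⟩ ?_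
  rintro E ⟨ψ, hψ, h1, rfl⟩
  exact two_mul_sum_fermiSet_le_re_expect_free hL hψ h1 F eF rfl hF hF'

/-- **The paired Fermi sea is an eigenvector of the free torus**: for `L ≥ 3` and any list `l` of
momenta, `H₀ Φ_l = (2 Σ_{k ∈ l} ε_L(k)) Φ_l` (`H₀ = Σ_k ε_k (n_{k↑} + n_{-k↓})` and
`n_{k↑} Φ_l = n_{-k↓} Φ_l = [k ∈ l] Φ_l`). Bardeen–Cooper–Schrieffer (1957) §II. [folklore] -/
theorem hubbardTorus_zero_mulVec_pairedState (hL : 3 ≤ L) (l : List (TorusSite 2 L)) :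
    hubbardTorus 2 L 1 0 *ᵥ ((List.map (fun k : TorusSite 2 L => (pairMode k)ᴴ) l).prod *ᵥ (vacuum : Fock (Orb (FermionTorus 2 L)))) = ((2 * ∑ k ∈ l.toFinset, torusBand L k : ℝ) : ℂ) • ((List.map (fun k : TorusSite 2 L => (pairMode k)ᴴ) l).prod *ᵥ (vacuum : Fock (Orb (FermionTorus 2 L)))) := by
  classical
  rw [← hubbardTorusWith_zero, hubbardTorusWith_zero_eq_sum_pairBlock_kinetic hL 0, Matrix.sum_mulVec]
  have hterm : ∀ k : TorusSite 2 L,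
      (((torusBand L k - 0 : ℝ) : ℂ) • (momentumNumber k 0 + momentumNumber (-k) 1)) *ᵥ ((List.map (fun k : TorusSite 2 L => (pairMode k)ᴴ) l).prod *ᵥ (vacuum : Fock (Orb (FermionTorus 2 L)))) =
        (if k ∈ l then (((2 * torusBand L k : ℝ)) : ℂ) else 0) • ((List.map (fun k : TorusSite 2 L => (pairMode k)ᴴ) l).prod *ᵥ (vacuum : Fock (Orb (FermionTorus 2 L)))) := by
    intro k
    rw [Matrix.smul_mulVec, add_mulVec]
    by_cases hk : k ∈ l
    · rw [momentumNumber_up_pairedState_of_mem hk, momentumNumber_down_pairedState_of_mem hk, if_pos hk,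
        ← two_smul ℂ, smul_smul]
      congr 1
      push_cast
      ring
    · rw [momentumNumber_up_pairedState_of_not_mem hk, momentumNumber_down_pairedState_of_not_mem hk,
        if_neg hk, add_zero, smul_zero, zero_smul]
  simp only [hterm]
  rw [← Finset.sum_smul]
  congr 1
  rw [← Finset.sum_filter]
  have hfilter : (Finset.univ.filter fun k : TorusSite 2 L => k ∈ l) = l.toFinset := by
    ext k; simp
  rw [hfilter]
  push_cast
  rw [Finset.mul_sum]

/-- The paired Fermi sea over a finite set of momenta is a unit vector, hence nonzero. [folklore] -/
theorem pairedState_toList_ne_zero (F : Finset (TorusSite 2 L)) : ((List.map (fun k : TorusSite 2 L => (pairMode k)ᴴ) F.toList).prod *ᵥ (vacuum : Fock (Orb (FermionTorus 2 L)))) ≠ 0 := by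
  intro h0
  have h1 := star_pairedState_dotProduct_self F.nodup_toList
  rw [h0, dotProduct_zero] at h1
  exact zero_ne_one h1

/-- **Paired Fermi seas are free ground states.** For `L ≥ 3` and a Fermi set `F` of band levels
(level `ε_F`), `Φ_F = Π_{k∈F} b†_k|0⟩` is a ground state of `hubbardTorus 2 L 1 0` in the joint sector
`(2|F|, S^z = 0)`. Bardeen–Cooper–Schrieffer (1957) §II; Lieb (1989). [folklore] -/
theorem isGroundStateInSector_pairedState_free (hL : 3 ≤ L) (F : Finset (TorusSite 2 L)) (eF : ℝ)
    (hF : ∀ k ∈ F, torusBand L k ≤ eF) (hF' : ∀ k ∉ F, eF ≤ torusBand L k) :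
    IsGroundStateInSector (hubbardTorus 2 L 1 0) (2 * F.card) 0 ((List.map (fun k : TorusSite 2 L => (pairMode k)ᴴ) F.toList).prod *ᵥ (vacuum : Fock (Orb (FermionTorus 2 L)))) := by
  classical
  refine ⟨?_, pairedState_toList_ne_zero F, ?_⟩
  · rw [← F.length_toList]; exact pairedState_mem_szSector F.toList
  · rw [hubbardTorus_zero_mulVec_pairedState hL, F.toList_toFinset,
      minEnergyOn_szSector_free_eq hL F eF hF hF']

omit [NeZero L] in
/-- **Paired seas over different momentum sets are not proportional**: if `q ∈ l'`, `q ∉ l` and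
`l'` is duplicate-free then `Φ_{l'} ≠ c • Φ_l` for every scalar `c` (`n_{q↑}` is `1` on `Φ_{l'}` and
`0` on `Φ_l`). [folklore] -/
theorem pairedState_ne_smul [NeZero L] {l l' : List (TorusSite 2 L)} (hl' : l'.Nodup)
    {q : TorusSite 2 L} (hq' : q ∈ l') (hq : q ∉ l) (c : ℂ) : ((List.map (fun k : TorusSite 2 L => (pairMode k)ᴴ) l').prod *ᵥ (vacuum : Fock (Orb (FermionTorus 2 L)))) ≠ c • ((List.map (fun k : TorusSite 2 L => (pairMode k)ᴴ) l).prod *ᵥ (vacuum : Fock (Orb (FermionTorus 2 L)))) := by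
  intro h
  have hA : momentumNumber q 0 *ᵥ ((List.map (fun k : TorusSite 2 L => (pairMode k)ᴴ) l').prod *ᵥ (vacuum : Fock (Orb (FermionTorus 2 L)))) = ((List.map (fun k : TorusSite 2 L => (pairMode k)ᴴ) l').prod *ᵥ (vacuum : Fock (Orb (FermionTorus 2 L)))) := momentumNumber_up_pairedState_of_mem hq'
  have hB : momentumNumber q 0 *ᵥ ((List.map (fun k : TorusSite 2 L => (pairMode k)ᴴ) l').prod *ᵥ (vacuum : Fock (Orb (FermionTorus 2 L)))) = 0 := by
    rw [h, mulVec_smul, momentumNumber_up_pairedState_of_not_mem hq, smul_zero]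
  rw [hB] at hA
  have h1 := star_pairedState_dotProduct_self hl'
  rw [← hA, dotProduct_zero] at h1
  exact zero_ne_one h1

/-- **An open free shell has a degenerate ground floor.** For `L ≥ 3`, a level `μ` and `n` with
`#{ε_L < μ} < n < #{ε_L ≤ μ}`, the sector `(2n, S^z = 0)` of `hubbardTorus 2 L 1 0` has two ground
states neither of which is a multiple of the other. [folklore] -/
theorem exists_two_groundStates_free_of_openShell (hL : 3 ≤ L) (μ : ℝ) (n : ℕ)
    (hlt : (univ.filter fun k : TorusSite 2 L => torusBand L k < μ).card < n)
    (hgt : n < (univ.filter fun k : TorusSite 2 L => torusBand L k ≤ μ).card) :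
    ∃ φ φ' : Fock (Orb (FermionTorus 2 L)),
      IsGroundStateInSector (hubbardTorus 2 L 1 0) (2 * n) 0 φ ∧
        IsGroundStateInSector (hubbardTorus 2 L 1 0) (2 * n) 0 φ' ∧ ∀ c : ℂ, φ' ≠ c • φ := by
  classical
  obtain ⟨F, F', hFc, hF'c, hF, hF', hG, hG', q, hq', hq⟩ :=
    exists_two_fermiSets (torusBand L) μ n hlt hgt
  refine ⟨((List.map (fun k : TorusSite 2 L => (pairMode k)ᴴ) F.toList).prod *ᵥ (vacuum : Fock (Orb (FermionTorus 2 L)))), ((List.map (fun k : TorusSite 2 L => (pairMode k)ᴴ) F'.toList).prod *ᵥ (vacuum : Fock (Orb (FermionTorus 2 L)))), ?_, ?_, fun c => ?_⟩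
  · rw [← hFc]; exact isGroundStateInSector_pairedState_free hL F μ hF hF'
  · rw [← hF'c]; exact isGroundStateInSector_pairedState_free hL F' μ hG hG'
  · exact pairedState_ne_smul F'.nodup_toList (F'.mem_toList.2 hq') (fun h => hq (F.mem_toList.1 h)) c

end Free

end Literature.MathematicalPhysics.QuantumLattice

end
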